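import Summits.CriticalPhenomena.PercolationContinuityZ3.Theorems.PercNearOneGluingNoHeavyLowerTailSahiSlotPairConeLiftCert
import Summits.CriticalPhenomena.PercolationContinuityZ3.Theorems.PercNearOneGluingNoHeavyLowerTailSahiGridPatternOrthant

/-!
# EVERY ORTHANT OF `[3]^d` HAS A PINNED (PIVOTAL-PAIR) CERTIFICATE, IN EVERY DIMENSION — axis-permutation transport of certificates
# and the format-level orthant induction

Support file of the one-cut programme (crux `NoHeavyLowerTail`, stmt-CriticalPhenomena-4575; cell `prim-masterthm`, seat P3, gen 23;
`run/shared/lean/prim/prim-masterthm/prim-masterthm-p3/HIERARCHY.md` §31, memo `FROM-prim-masterthm-p3-g23-FORMAT-LIFTS.md`).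

* `orthant p = {x : p ≤ x}`, `orthant_eq_liftTwo/liftTop` (last threshold `1` / `2`), and **`pinnedGood_orthant : ∀ d p, PinnedGood d (orthant p)`** —
  prim-sahi-p1's orthant theorem `sStarD_principal_nonneg` (generation 9, VALUE level) lifted to the certificate FORMAT: induction on `d`, a nonzero
  threshold is moved to the last axis, then `PinnedGood.liftTwo` / `PinnedGood.liftTop` (`…SahiSlotPairConeLiftCert`); `p = 0` is `⊤`
  (gen 22's Harris-slack certificate).  Value-level corollary `sStarD_orthant_nonneg'`.
So the pivotal-pair conjecture (`PinnedLitCert d 2` for all `d`) holds on the orthant stratum in every dimension, with explicit certificates.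
HONEST LABEL: certificate-format theorem on a stratum where positivity was known (p1 gen 9 coefficientwise; Sahi 2008 Thm 2 at fixed weight);
no open cell changes status.  Pure, standard axioms. [this work]
-/

noncomputable section

namespace Summit.CriticalPhenomena.PercolationContinuityZ3.Theorems

open Finset Function
open Literature.Combinatorics.Sahi2008

namespace SahiSlot

open SahiGridPattern SahiGrid3

variable {n : ℕ}

/-- The orthant (principal up-set) `↑p = {x : p ≤ x}`. [this work] -/
def orthant {d : ℕ} (p : Pd d) : Finset (Pd d) := univ.filter fun x => ∀ a, p a ≤ x a

/-- An orthant whose last threshold is `1` is the two-level lift of the orthant of the other thresholds. [this work] -/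
theorem orthant_eq_liftTwo (q : Pd (n + 1)) (h1 : q (Fin.last n) = 1) : orthant q = liftTwo (orthant (fun b => q (Fin.castSucc b))) := by
  ext x
  simp only [orthant, liftTwo, Finset.mem_filter, Finset.mem_univ, true_and]
  conv_lhs => rw [← Fin.snoc_init_self x]
  rw [le_snoc_iff, h1]
  have key : ∀ i : Fin 3, (1 ≤ i ↔ i ≠ 0) := by decide
  rw [key]

/-- An orthant whose last threshold is `2` is the top-only lift. [this work] -/
theorem orthant_eq_liftTop (q : Pd (n + 1)) (h2 : q (Fin.last n) = 2) : orthant q = liftTop (orthant (fun b => q (Fin.castSucc b))) := by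
  ext x
  simp only [orthant, liftTop, Finset.mem_filter, Finset.mem_univ, true_and]
  conv_lhs => rw [← Fin.snoc_init_self x]
  rw [le_snoc_iff, h2]
  have key : ∀ i : Fin 3, (2 ≤ i ↔ i = 2) := by decide
  rw [key]

/-- **EVERY ORTHANT HAS A PINNED (PIVOTAL-PAIR) CERTIFICATE, IN EVERY DIMENSION** — the format-level version of prim-sahi-p1's orthant theorem
`sStarD_principal_nonneg` (induction on `d`: move a nonzero threshold to the last axis by `PinnedGood.perm`, then `liftTwo`/`liftTop`;
`p = 0` is `⊤`, gen 22's Harris-slack certificate). [this work] -/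
theorem pinnedGood_orthant : ∀ (d : ℕ) (p : Pd d), PinnedGood d (orthant p) := by
  intro d
  induction d with
  | zero =>
    intro p
    have e : orthant p = univ := by
      ext x; simp only [orthant, Finset.mem_filter, Finset.mem_univ, true_and, iff_true]; exact fun a => Fin.elim0 a
    rw [e]; exact pinnedGood_univ 0
  | succ n ih =>
    intro p
    by_cases hz : ∃ a, p a ≠ 0
    · obtain ⟨a, ha⟩ := hz
      let τ : Equiv.Perm (Fin (n + 1)) := Equiv.swap a (Fin.last n)
      have hq : (p ∘ ⇑τ) (Fin.last n) ≠ 0 := by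
        show p (τ (Fin.last n)) ≠ 0
        rw [Equiv.swap_apply_right]; exact ha
      have hup : IsUpperSet ((orthant (fun b => (p ∘ ⇑τ) (Fin.castSucc b)) : Finset (Pd n)) : Set (Pd n)) := isUpperSet_filter_le _
      have step : PinnedGood (n + 1) (orthant (p ∘ ⇑τ)) := by
        have hcases : (p ∘ ⇑τ) (Fin.last n) = 1 ∨ (p ∘ ⇑τ) (Fin.last n) = 2 := by
          have key : ∀ i : Fin 3, i ≠ 0 → i = 1 ∨ i = 2 := by decide
          exact key _ hq
        rcases hcases with h1 | h2
        · rw [orthant_eq_liftTwo _ h1]; exact (ih _).liftTwo hup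
        · rw [orthant_eq_liftTop _ h2]; exact (ih _).liftTop hup
      refine step.perm τ fun x => ?_
      simp only [orthant, Finset.mem_filter, Finset.mem_univ, true_and, Function.comp_apply]
      constructor
      · intro h b; exact h (τ b)
      · intro h b
        have := h (τ.symm b)
        simpa using this
    · simp only [not_exists, not_not] at hz
      have e : orthant p = univ := by
        ext x; simp only [orthant, Finset.mem_filter, Finset.mem_univ, true_and, iff_true]
        intro a; rw [hz a]; exact Fin.zero_le _
      rw [e]; exact pinnedGood_univ (n + 1)

/-- VALUE-LEVEL corollary: prim-sahi-p1's orthant theorem, recovered from the certificates. [this work] -/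
theorem sStarD_orthant_nonneg' {d : ℕ} (p : Pd d) (B C : Finset (Pd d)) (hB : IsUpperSet (B : Set (Pd d))) (hC : IsUpperSet (C : Set (Pd d))) :
    0 ≤ sStarD (orthant p) B C :=
  (pinnedGood_orthant d p).sStarD_nonneg B C hB hC

end SahiSlot

end Summit.CriticalPhenomena.PercolationContinuityZ3.Theorems
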